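import Mathlib.Data.Rat.Denumerable
import Literature.Probability.RandomPlanarGeometry.HalfPlaneAnchors
import Literature.Probability.RandomPlanarGeometry.BoundaryCorrespondence
import Literature.Probability.RandomPlanarGeometry.SimpleCurveLaws
import HarnessLib

/-!
# The countable test family on a Dobrushin domain and separation of chordal simple curves

Step T2b of the transposition of [LSW] Thm. 6.1 to `Literature.Probability.RandomPlanarGeometry.IsSLELaw.hullRestriction_eightThirds`
(plan in `ConformalRestrictionProofs`; G. F. Lawler, O. Schramm, W. Werner, *Conformal
restriction: the chordal case*, J. Amer. Math. Soc. **16** (2003), arXiv:math/0209343,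
Lemma 3.2 p. 10: laws of random sets from `0` to `∞` in `ℍ` are determined by the avoidance
probabilities of `*`-hulls). To apply the transfer theorem
`CurveClass.Measure.ext_of_missCode_injOn` (`SimpleCurveLaws`) to two laws of chordal simple
curves in `(D'; a, b)` we need a SEQUENCE of closed test sets whose avoidance code is injective
on those curves. PROVED here:

* `Literature.anchoredSeq n` — an enumeration (through `Denumerable (List (ℚ × ℚ × ℚ))`) of the
  anchored rational test sets of the half-plane (`HalfPlaneAnchors.testSet`, `IsAnchored`),
  with `∅` at the non-anchored indices; finite unions stay anchored or empty
  (`biUnion_anchoredSeq`);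
* `Literature.imageTest ψ n = ψ.boundaryExtension '' anchoredSeq n` — their images in `cl D'` under
  the boundary extension of a chordal uniformizing map `ψ` of `(D'; a, b)` (compact);
* `Literature.chordalCarrier D'` — the Borel set of simple curve classes from `a` to `b` with trace
  in `D' ∪ {a, b}` (`measurableSet_chordalCarrier`: the trace condition is
  "`⊆ cl D'` and missing the compact pieces `∂D' ∖ (B(a, 1/k) ∪ B(b, 1/k))`");
* `Literature.Probability.RandomPlanarGeometry.injOn_missCode_imageTest` — **the avoidance code of `imageTest ψ` is injective on
  `chordalCarrier D'`**: two such classes with different traces are separated by some test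
  set. Pull the second trace back to `ℍ ∪ {0}` by `ψ⁻¹` — a simple path from `0` to `∞`
  (inverse boundary behaviour of `ψ` at `a` and `b`, Carathéodory `hC`), whose complement is
  connected (`isConnected_compl_image_of_tendsto_cocompact`, from `JordanArcSeparation`
  `hJarc`) — and separate a pulled-back point of the first trace from it by an anchored test
  set (`exists_anchored_testSet`); the boundary correspondence (`BoundaryCorrespondence`)
  translates avoidance back to `D'`.
-/

noncomputable section

open Set Filter Topology Metric Complex
open UpperHalfPlane (upperHalfPlaneSet isOpen_upperHalfPlaneSet)
open scoped NNReal unitInterval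

namespace Literature.Probability.RandomPlanarGeometry

/-! ### The enumerated anchored test family of the half-plane -/

open Classical in
/-- The `n`-th anchored test set: the test set of the `n`-th list of rational triples if it is
anchored, `∅` otherwise. [folklore] -/
def anchoredSeq (n : ℕ) : Set ℂ :=
  if IsAnchored (testSet (Denumerable.ofNat (List (ℚ × ℚ × ℚ)) n)) then
    testSet (Denumerable.ofNat (List (ℚ × ℚ × ℚ)) n) else ∅

/-- Each anchored test set occurs in the sequence. [folklore] -/
theorem exists_anchoredSeq_eq {l : List (ℚ × ℚ × ℚ)} (hl : IsAnchored (testSet l)) :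
    ∃ n, anchoredSeq n = testSet l := by
  obtain ⟨n, hn⟩ : ∃ n, Denumerable.ofNat (List (ℚ × ℚ × ℚ)) n = l :=
    ⟨_, Denumerable.ofNat_encode l⟩
  refine ⟨n, ?_⟩
  unfold anchoredSeq
  rw [hn, if_pos hl]

/-- Every term of the sequence is a test set or empty. [folklore] -/
theorem anchoredSeq_eq (n : ℕ) :
    ∃ l : List (ℚ × ℚ × ℚ), anchoredSeq n = testSet l ∧ (IsAnchored (testSet l) ∨ l = []) := by
  classical
  unfold anchoredSeq
  split_ifs with h
  · exact ⟨_, rfl, Or.inl h⟩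
  · exact ⟨[], testSet_nil.symm, Or.inr rfl⟩

/-- Every term of the sequence is empty or anchored. [folklore] -/
theorem anchoredSeq_empty_or (n : ℕ) : anchoredSeq n = ∅ ∨ IsAnchored (anchoredSeq n) := by
  classical
  unfold anchoredSeq
  split_ifs with h
  · exact Or.inr h
  · exact Or.inl rfl

/-- The terms of the sequence are compact. [folklore] -/
theorem isCompact_anchoredSeq (n : ℕ) : IsCompact (anchoredSeq n) := by
  obtain ⟨l, hl, -⟩ := anchoredSeq_eq n
  rw [hl]; exact isCompact_testSet l

/-- The terms of the sequence lie in the closed half-plane. [folklore] -/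
theorem anchoredSeq_subset_closure (n : ℕ) : anchoredSeq n ⊆ closure upperHalfPlaneSet := by
  obtain ⟨l, hl, -⟩ := anchoredSeq_eq n
  rw [hl]; exact testSet_subset_closure l

/-- **Finite unions of terms are empty or anchored** (and compact, in `ℍ̄`, off `0`). [folklore] -/
theorem biUnion_anchoredSeq (s : Finset ℕ) :
    ((⋃ n ∈ s, anchoredSeq n) = ∅ ∨ IsAnchored (⋃ n ∈ s, anchoredSeq n)) ∧
      IsCompact (⋃ n ∈ s, anchoredSeq n) ∧ (⋃ n ∈ s, anchoredSeq n) ⊆ closure upperHalfPlaneSet ∧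
      (0 : ℂ) ∉ ⋃ n ∈ s, anchoredSeq n := by
  classical
  refine ⟨?_, s.finite_toSet.isCompact_biUnion fun n _ ↦ isCompact_anchoredSeq n,
    iUnion₂_subset fun n _ ↦ anchoredSeq_subset_closure n, ?_⟩
  · induction s using Finset.induction_on with
    | empty => left; simp
    | insert a s ha ih =>
      rw [Finset.set_biUnion_insert]
      rcases anchoredSeq_empty_or a with h0 | hA
      · rw [h0, empty_union]; exact ih
      · rcases ih with h0' | hA'
        · rw [h0', union_empty]; exact Or.inr hA
        · exact Or.inr (hA.union hA')
  · simp only [mem_iUnion, exists_prop, not_exists, not_and]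
    intro n _ h0
    rcases anchoredSeq_empty_or n with h | h
    · rw [h] at h0; exact h0
    · exact h.1 h0

/-! ### The image test sets on a Dobrushin domain -/

section Image

variable {D' : DobrushinDomain} (ψ : ConformalEquiv upperHalfPlaneSet D'.carrier)

/-- The **image test sets**: `ψ.boundaryExtension '' anchoredSeq n ⊆ cl D'`. [folklore] -/
def imageTest (n : ℕ) : Set ℂ := ψ.boundaryExtension '' anchoredSeq n

variable {ψ}

/-- Image test sets are closed (compact). [folklore] -/
theorem isClosed_imageTest (hC : JordanDomain.exists_continuousOn_extension) (n : ℕ) :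
    IsClosed (imageTest ψ n) :=
  (MarkedDomain.isCompact_image_boundaryExtension hC (anchoredSeq_subset_closure n)
    (isCompact_anchoredSeq n)).isClosed

/-- Finite unions of image test sets are images of finite unions. [folklore] -/
theorem biUnion_imageTest (s : Finset ℕ) :
    (⋃ n ∈ s, imageTest ψ n) = ψ.boundaryExtension '' ⋃ n ∈ s, anchoredSeq n := by
  simp only [imageTest, image_iUnion]

end Image

/-! ### The Borel set of chordal simple curves in `(D'; a, b)` -/

section Carrier

variable (D' : DobrushinDomain)

/-- The **chordal carrier** of `(D'; a, b)`: simple curve classes from `a` to `b` whose trace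
lies in `D' ∪ {a, b}` — the classes charged by chordal SLE laws of `D'`. [folklore] -/
def chordalCarrier : Set (CurveClass ℂ) :=
  CurveClass.simple ∩ {c | c.source = D'.pt 0} ∩ {c | c.target = D'.pt 1} ∩
    {c | c.range ⊆ D'.carrier ∪ {D'.pt 0, D'.pt 1}}

/-- The compact pieces `∂D' ∖ (B(a, 1/(k+1)) ∪ B(b, 1/(k+1)))` of the boundary off the marked
points. [folklore] -/
def frontierPiece (k : ℕ) : Set ℂ :=
  frontier D'.carrier \ (ball (D'.pt 0) (1 / ((k : ℝ) + 1)) ∪ ball (D'.pt 1) (1 / ((k : ℝ) + 1)))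

variable {D'}

/-- The boundary pieces are closed. [folklore] -/
theorem isClosed_frontierPiece (k : ℕ) : IsClosed (frontierPiece D' k) :=
  isClosed_frontier.sdiff (isOpen_ball.union isOpen_ball)

/-- **The trace condition is Borel**: `range ⊆ D' ∪ {a, b}` iff `range ⊆ cl D'` and the trace
misses every boundary piece. [folklore] -/
theorem setOf_range_subset_eq :
    {c : CurveClass ℂ | c.range ⊆ D'.carrier ∪ {D'.pt 0, D'.pt 1}} =
      CurveClass.rangeSubset (closure D'.carrier) ∩
        ⋂ k, CurveClass.rangeSubset (frontierPiece D' k)ᶜ := by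
  ext c
  simp only [mem_setOf_eq, mem_inter_iff, mem_iInter, CurveClass.mem_rangeSubset]
  constructor
  · intro h
    refine ⟨h.trans ?_, fun k w hw hwZ ↦ ?_⟩
    · rintro w (hw | hw)
      · exact subset_closure hw
      · rcases hw with rfl | rfl <;> exact frontier_subset_closure (D'.pt_mem_frontier _)
    · rcases h hw with hwD | hab
      · rw [frontierPiece, D'.isOpen.frontier_eq] at hwZ
        exact hwZ.1.2 hwD
      · have hk : (0 : ℝ) < 1 / ((k : ℝ) + 1) := by positivity
        rcases hab with rfl | rfl
        · exact hwZ.2 (Or.inl (mem_ball_self hk))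
        · exact hwZ.2 (Or.inr (mem_ball_self hk))
  · rintro ⟨hcl, hZ⟩ w hw
    have hwcl := hcl hw
    rw [closure_eq_self_union_frontier] at hwcl
    rcases hwcl with hwD | hwfr
    · exact Or.inl hwD
    · right
      by_contra hab
      simp only [mem_insert_iff, mem_singleton_iff, not_or] at hab
      -- `w` is at positive distance from `a` and `b`, hence in some boundary piece
      have hda : 0 < dist w (D'.pt 0) := dist_pos.2 hab.1
      have hdb : 0 < dist w (D'.pt 1) := dist_pos.2 hab.2
      obtain ⟨k, hk⟩ := exists_nat_one_div_lt (lt_min hda hdb)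
      refine hZ k hw ⟨hwfr, ?_⟩
      rintro (h | h) <;> rw [mem_ball] at h
      · linarith [min_le_left (dist w (D'.pt 0)) (dist w (D'.pt 1))]
      · linarith [min_le_right (dist w (D'.pt 0)) (dist w (D'.pt 1))]

/-- **The chordal carrier is a Borel set.** [folklore] -/
theorem measurableSet_chordalCarrier : MeasurableSet (chordalCarrier D') := by
  refine ((CurveClass.measurableSet_simple'.inter
    (isClosed_eq CurveClass.continuous_source continuous_const).measurableSet).inter
    (isClosed_eq CurveClass.continuous_target continuous_const).measurableSet).inter ?_
  rw [setOf_range_subset_eq]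
  exact (CurveClass.measurableSet_rangeSubset isClosed_closure).inter
    (MeasurableSet.iInter fun k ↦
      CurveClass.measurableSet_rangeSubset_compl (isClosed_frontierPiece k))

end Carrier

/-! ### Separation: the avoidance code is injective on the chordal carrier -/

section Separation

variable {D' : DobrushinDomain} {ψ : ConformalEquiv upperHalfPlaneSet D'.carrier}

/-- Interior parameters of a chordal simple curve are mapped into `D'`. [folklore] -/
theorem apply_mem_carrier_of_chordal {γ : Curve ℂ} (hγ : γ.IsSimple) (h0 : γ 0 = D'.pt 0)
    (h1 : γ 1 = D'.pt 1) (hr : Set.range γ ⊆ D'.carrier ∪ {D'.pt 0, D'.pt 1}) {t : I}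
    (ht0 : t ≠ 0) (ht1 : t ≠ 1) : γ t ∈ D'.carrier := by
  rcases hr ⟨t, rfl⟩ with h | h
  · exact h
  · rcases h with h | h
    · exact absurd (hγ (h.trans h0.symm)) ht0
    · exact absurd (hγ (h.trans h1.symm)) ht1

/-- **The pulled-back trace of a chordal simple curve is a simple path from `0` to `∞` whose
complement is connected.** For `γ` injective from `a` to `b` in `D' ∪ {a, b}` and `ψ` a
chordal uniformizing map of `(D'; a, b)`: the set `K = {0} ∪ ψ⁻¹(γ(0,1))` is closed, lies in
`ℍ ∪ {0}`, misses `−i`, and `ℂ ∖ K` is connected (`JordanArcSeparation`, Carathéodory).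
[folklore] -/
theorem pullback_trace_spec (hJarc : Literature.Topology.PlaneTopology.JordanArcSeparation)
    (hC : JordanDomain.exists_continuousOn_extension) (hψ : D'.IsChordalUniformizing ψ)
    {γ : Curve ℂ} (hγ : γ.IsSimple) (h0 : γ 0 = D'.pt 0) (h1 : γ 1 = D'.pt 1)
    (hr : Set.range γ ⊆ D'.carrier ∪ {D'.pt 0, D'.pt 1}) :
    ∃ K : Set ℂ, IsClosed K ∧ IsConnected Kᶜ ∧ (0 : ℂ) ∈ K ∧ K ⊆ upperHalfPlaneSet ∪ {0} ∧
      (∀ t : I, t ≠ 0 → t ≠ 1 → ψ.symm (γ t) ∈ K) ∧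
      ∀ z ∈ K, z ≠ 0 → ∃ t : I, t ≠ 0 ∧ t ≠ 1 ∧ z = ψ.symm (γ t) := by
  classical
  -- Carathéodory data for `ψ`
  obtain ⟨Ψ, hΨc, hΨeq, hbij, -⟩ := hC D'.toJordanDomain (cayley.symm.trans ψ)
  have hinj : InjOn Ψ (closedBall 0 1) := hbij.injOn
  have hmemD : ∀ t : I, t ≠ 0 → t ≠ 1 → γ t ∈ D'.carrier :=
    fun t ht0 ht1 ↦ apply_mem_carrier_of_chordal hγ h0 h1 hr ht0 ht1
  -- the path `β : [0, 1) → ℂ`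
  set β : ℝ → ℂ := fun t ↦ if t ≤ 0 then 0 else ψ.symm (γ (projIcc 0 1 zero_le_one t)) with hβ
  have hβ0 : β 0 = 0 := if_pos le_rfl
  have hβpos : ∀ {t : ℝ}, 0 < t → β t = ψ.symm (γ (projIcc 0 1 zero_le_one t)) :=
    fun ht ↦ if_neg (not_le.2 ht)
  have hproj : ∀ {t : ℝ}, 0 < t → t < 1 →
      projIcc 0 1 zero_le_one t ≠ 0 ∧ projIcc 0 1 zero_le_one t ≠ 1 := by
    intro t ht0 ht1
    rw [projIcc_of_mem zero_le_one ⟨ht0.le, ht1.le⟩]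
    exact ⟨fun h ↦ ht0.ne' (congrArg Subtype.val h), fun h ↦ ht1.ne (congrArg Subtype.val h)⟩
  have hβH : ∀ {t : ℝ}, 0 < t → t < 1 → β t ∈ upperHalfPlaneSet := by
    intro t ht0 ht1
    rw [hβpos ht0]
    exact ψ.symm_mapsTo (hmemD _ (hproj ht0 ht1).1 (hproj ht0 ht1).2)
  -- continuity on `[0, 1)`
  have hγc : Continuous fun t : ℝ ↦ γ (projIcc 0 1 zero_le_one t) :=
    γ.toContinuousMap.continuous.comp continuous_projIcc
  have hβc : ContinuousOn β (Ico 0 1) := by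
    intro t ht
    rcases ht.1.lt_or_eq with ht0 | rfl
    · -- `t > 0`: locally `β = ψ⁻¹ ∘ γ ∘ projIcc`, continuous at `t`
      have hev : β =ᶠ[𝓝 t] fun s ↦ ψ.symm (γ (projIcc 0 1 zero_le_one s)) :=
        eventually_of_mem (Ioi_mem_nhds ht0) fun s hs ↦ hβpos hs
      refine (ContinuousAt.congr ?_ hev.symm).continuousWithinAt
      have h1 : ContinuousAt ψ.symm (γ (projIcc 0 1 zero_le_one t)) :=
        ψ.symm.continuousOn.continuousAt
          (D'.isOpen.mem_nhds (hmemD _ (hproj ht0 ht.2).1 (hproj ht0 ht.2).2))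
      exact ContinuousAt.comp (f := fun s : ℝ ↦ γ (projIcc 0 1 zero_le_one s)) h1 hγc.continuousAt
    · -- at `0`: `ψ⁻¹ (γ s) → 0` as `s → 0⁺`
      change Tendsto β (𝓝[Ico 0 1] 0) (𝓝 (β 0))
      rw [hβ0]
      have hsplit : Ico (0 : ℝ) 1 = {0} ∪ Ioo 0 1 := by
        ext s; simp only [mem_Ico, mem_union, mem_singleton_iff, mem_Ioo]
        constructor
        · rintro ⟨h1, h2⟩
          rcases h1.lt_or_eq with h | h
          · exact Or.inr ⟨h, h2⟩
          · exact Or.inl h.symm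
        · rintro (rfl | ⟨h1, h2⟩)
          · exact ⟨le_rfl, one_pos⟩
          · exact ⟨h1.le, h2⟩
      rw [hsplit, nhdsWithin_union, nhdsWithin_singleton]
      refine tendsto_sup.2 ⟨?_, ?_⟩
      · rw [← hβ0]; exact tendsto_pure_nhds β 0
      · have hγa : Tendsto (fun s : ℝ ↦ γ (projIcc 0 1 zero_le_one s)) (𝓝[Ioo 0 1] 0)
            (𝓝[D'.carrier] (D'.pt 0)) := by
          refine tendsto_nhdsWithin_iff.2 ⟨?_, ?_⟩
          · have := hγc.tendsto 0
            rw [projIcc_of_le_left zero_le_one le_rfl,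
              show (⟨(0 : ℝ), left_mem_Icc.2 zero_le_one⟩ : I) = 0 from rfl, h0] at this
            exact this.mono_left nhdsWithin_le_nhds
          · filter_upwards [self_mem_nhdsWithin] with s hs
            exact hmemD _ (hproj hs.1 hs.2).1 (hproj hs.1 hs.2).2
        have hsymm : Tendsto ψ.symm (𝓝[D'.carrier] (D'.pt 0)) (𝓝 ((0 : ℝ) : ℂ)) :=
          JordanDomain.tendsto_symm_nhds ψ hΨc hΨeq hinj (x := 0) (by exact_mod_cast hψ.1)
        rw [ofReal_zero] at hsymm
        refine (hsymm.comp hγa).congr' ?_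
        filter_upwards [self_mem_nhdsWithin] with s hs
        exact (hβpos hs.1).symm
  -- injectivity on `[0, 1)`
  have hβi : InjOn β (Ico 0 1) := by
    intro s hs t ht hst
    rcases hs.1.lt_or_eq with hs0 | hs0 <;> rcases ht.1.lt_or_eq with ht0 | ht0
    · rw [hβpos hs0, hβpos ht0] at hst
      have h1 := ψ.symm.injOn (hmemD _ (hproj hs0 hs.2).1 (hproj hs0 hs.2).2)
        (hmemD _ (hproj ht0 ht.2).1 (hproj ht0 ht.2).2) hst
      have h2 := congrArg Subtype.val (hγ h1)
      rwa [projIcc_of_mem zero_le_one ⟨hs0.le, hs.2.le⟩,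
        projIcc_of_mem zero_le_one ⟨ht0.le, ht.2.le⟩] at h2
    · exfalso
      have := hβH hs0 hs.2
      rw [hst, ← ht0, hβ0] at this
      exact absurd (show (0 : ℝ) < (0 : ℂ).im from this) (by simp)
    · exfalso
      have := hβH ht0 ht.2
      rw [← hst, ← hs0, hβ0] at this
      exact absurd (show (0 : ℝ) < (0 : ℂ).im from this) (by simp)
    · rw [← hs0, ← ht0]
  -- `β → ∞` at `1`
  have hβinf : Tendsto β (𝓝[<] 1) (cocompact ℂ) := by
    have hγb : Tendsto (fun s : ℝ ↦ γ (projIcc 0 1 zero_le_one s)) (𝓝[<] 1)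
        (𝓝[D'.carrier] (D'.pt 1)) := by
      refine tendsto_nhdsWithin_iff.2 ⟨?_, ?_⟩
      · have := hγc.tendsto 1
        rw [projIcc_of_right_le zero_le_one le_rfl,
          show (⟨(1 : ℝ), right_mem_Icc.2 zero_le_one⟩ : I) = 1 from rfl, h1] at this
        exact this.mono_left nhdsWithin_le_nhds
      · filter_upwards [Ioo_mem_nhdsLT one_pos] with s hs
        exact hmemD _ (hproj hs.1 hs.2).1 (hproj hs.1 hs.2).2
    have hsymm := JordanDomain.tendsto_symm_cocompact ψ hΨc hΨeq hinj hψ.2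
    refine (hsymm.comp hγb).congr' ?_
    filter_upwards [Ioo_mem_nhdsLT one_pos] with s hs
    exact (hβpos hs.1).symm
  -- the set `K`
  set K := β '' Ico 0 1 with hK
  have hKsub : K ⊆ upperHalfPlaneSet ∪ {0} := by
    rintro _ ⟨t, ht, rfl⟩
    rcases ht.1.lt_or_eq with ht0 | rfl
    · exact Or.inl (hβH ht0 ht.2)
    · exact Or.inr (by rw [hβ0]; rfl)
  have hI : -Complex.I ∉ K := by
    intro h
    rcases hKsub h with h1 | h1
    · exact absurd (show (0 : ℝ) < (-Complex.I).im from h1) (by simp)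
    · simp at h1
  refine ⟨K, isClosed_image_of_tendsto_cocompact hβc hβinf,
    isConnected_compl_image_of_tendsto_cocompact hJarc hβc hβi hβinf hI,
    ⟨0, ⟨le_rfl, one_pos⟩, hβ0⟩, hKsub, ?_, ?_⟩
  · intro t ht0 ht1
    have ht0' : (0 : ℝ) < t := lt_of_le_of_ne t.2.1 fun h ↦ ht0 (Subtype.ext h.symm)
    have ht1' : (t : ℝ) < 1 := lt_of_le_of_ne t.2.2 fun h ↦ ht1 (Subtype.ext h)
    refine ⟨t, ⟨t.2.1, ht1'⟩, ?_⟩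
    rw [hβpos ht0', projIcc_val zero_le_one t]
  · rintro z ⟨t, ht, rfl⟩ hz0
    rcases ht.1.lt_or_eq with ht0 | rfl
    · refine ⟨projIcc 0 1 zero_le_one t, (hproj ht0 ht.2).1, (hproj ht0 ht.2).2, hβpos ht0⟩
    · exact absurd hβ0 hz0

/-- **A point of one chordal trace off another is separated by an image test set.** [folklore] -/
theorem exists_index_separating (hJarc : Literature.Topology.PlaneTopology.JordanArcSeparation)
    (hC : JordanDomain.exists_continuousOn_extension) (hψ : D'.IsChordalUniformizing ψ)
    {c₁ c₂ : CurveClass ℂ} (h₁ : c₁ ∈ chordalCarrier D') (h₂ : c₂ ∈ chordalCarrier D')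
    {w : ℂ} (hw₁ : w ∈ c₁.range) (hw₂ : w ∉ c₂.range) :
    ∃ n, ¬ Disjoint c₁.range (imageTest ψ n) ∧ Disjoint c₂.range (imageTest ψ n) := by
  obtain ⟨⟨⟨⟨γ₂, hγ₂, rfl⟩, hs₂⟩, ht₂⟩, hr₂⟩ := h₂
  simp only [mem_setOf_eq, CurveClass.source_mk, CurveClass.target_mk, CurveClass.range_mk]
    at hs₂ ht₂ hr₂ hw₂
  have h0 : γ₂ 0 = D'.pt 0 := hs₂
  have h1 : γ₂ 1 = D'.pt 1 := ht₂
  -- `w ∈ D'`: it is on the first trace and is neither `a` nor `b` (both on the second)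
  have hwa : w ≠ D'.pt 0 := fun h ↦ hw₂ ⟨0, h0.trans h.symm⟩
  have hwb : w ≠ D'.pt 1 := fun h ↦ hw₂ ⟨1, h1.trans h.symm⟩
  have hwD : w ∈ D'.carrier := by
    rcases h₁.2 hw₁ with h | h
    · exact h
    · rcases h with h | h
      · exact absurd h hwa
      · exact absurd h hwb
  set z := ψ.symm w with hz
  have hzH : z ∈ upperHalfPlaneSet := ψ.symm_mapsTo hwD
  -- the pulled-back second trace
  obtain ⟨K, hKcl, hKc, h0K, hKsub, hKmem, hKrep⟩ := pullback_trace_spec hJarc hC hψ hγ₂ h0 h1 hr₂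
  have hzK : z ∉ K := by
    intro hzK'
    have hz0 : z ≠ 0 := by
      rintro h; rw [h] at hzH; exact absurd (show (0:ℝ) < (0:ℂ).im from hzH) (by simp)
    obtain ⟨t, ht0, ht1, hzt⟩ := hKrep z hzK' hz0
    apply hw₂
    refine ⟨t, ?_⟩
    have := congrArg ψ hzt
    rw [hz, ψ.apply_symm_apply hwD,
      ψ.apply_symm_apply (apply_mem_carrier_of_chordal hγ₂ h0 h1 hr₂ ht0 ht1)] at this
    exact this.symm
  -- an anchored test set through `z` missing `K`
  obtain ⟨l, hl, hzl, hlK⟩ := exists_anchored_testSet hKcl hKc h0K hKsub hzH hzK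
  obtain ⟨n, hn⟩ := exists_anchoredSeq_eq hl
  refine ⟨n, ?_, ?_⟩
  · rw [imageTest, hn, Set.not_disjoint_iff]
    refine ⟨w, hw₁, z, hzl, ?_⟩
    rw [ψ.boundaryExtension_eq hzH, hz, ψ.apply_symm_apply hwD]
  · rw [imageTest, hn]
    refine (MarkedDomain.disjoint_image_boundaryExtension_iff hC hψ (testSet_subset_closure l)
      hl.1 hr₂).2 ?_
    rintro v ⟨⟨t, rfl⟩, hvD⟩ hvS
    have ht0 : t ≠ 0 := by rintro rfl; exact D'.pt_notMem_carrier 0 (h0 ▸ hvD)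
    have ht1 : t ≠ 1 := by rintro rfl; exact D'.pt_notMem_carrier 1 (h1 ▸ hvD)
    exact Set.disjoint_left.1 hlK hvS (hKmem t ht0 ht1)

/-- **The avoidance code of the image test sets is injective on the chordal carrier.** Two
distinct simple classes from `a` to `b` in `D' ∪ {a, b}` have distinct traces
(`CurveClass.eq_of_mem_simple_of_range_eq`), and a point of one trace off the other is
separated by an image test set (`exists_index_separating`). [folklore] -/
theorem injOn_missCode_imageTest (hJarc : Literature.Topology.PlaneTopology.JordanArcSeparation)
    (hC : JordanDomain.exists_continuousOn_extension) (hψ : D'.IsChordalUniformizing ψ) :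
    InjOn (CurveClass.missCode (imageTest ψ)) (chordalCarrier D') := by
  intro c₁ h₁ c₂ h₂ hcode
  by_contra hne
  have hrange : c₁.range ≠ c₂.range := fun h ↦
    hne (CurveClass.eq_of_mem_simple_of_range_eq h₁.1.1.1 h₂.1.1.1 h (h₁.1.1.2.trans h₂.1.1.2.symm))
  -- a point of one trace off the other
  have key : ∀ {d₁ d₂ : CurveClass ℂ}, d₁ ∈ chordalCarrier D' → d₂ ∈ chordalCarrier D' →
      CurveClass.missCode (imageTest ψ) d₁ = CurveClass.missCode (imageTest ψ) d₂ →
      d₁.range ⊆ d₂.range := by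
    intro d₁ d₂ hd₁ hd₂ hd w hw
    by_contra hw₂
    obtain ⟨n, hn₁, hn₂⟩ := exists_index_separating hJarc hC hψ hd₁ hd₂ hw hw₂
    have h2 : CurveClass.missCode (imageTest ψ) d₂ n = true := CurveClass.missCode_eq_true_iff.2 hn₂
    have h1 : CurveClass.missCode (imageTest ψ) d₁ n = true := by rw [hd]; exact h2
    exact hn₁ (CurveClass.missCode_eq_true_iff.1 h1)
  exact hrange ((key h₁ h₂ hcode).antisymm (key h₂ h₁ hcode.symm))

end Separation

end Literature.Probability.RandomPlanarGeometry

end
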